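import Mathlib
import HarnessLib
import Literature.MathematicalPhysics.KineticTheory.HardSphereEulerProofs
import Literature.Analysis.FluidPDE.CollisionalTransfer
import Summits.AtomisticToContinuum.HydrodynamicLimit.Theses.OneFlightGossipEngine
import Summits.AtomisticToContinuum.HydrodynamicLimit.Theorems.OneFlightGossipEngineKineticCurrentsLDAlongFamiliesWindowRenyiOfTransport
import Summits.AtomisticToContinuum.HydrodynamicLimit.Theorems.OneFlightGossipEngineKineticCurrentsWindowLDUniformFibreExpMoment
import Summits.AtomisticToContinuum.HydrodynamicLimit.Theorems.OneFlightGossipEngineKineticCurrentsLDAlongFamiliesDisplacementTightnessPrelim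

/-!
# Displacement half of the kinetic-window transport tightness is decay-free — helper toward the open
# stub `stub_windowTransportFamily` (S2'') of line `Sketch`, crux `KineticCurrentsLDAlongFamilies`
# (stmt-AtomisticToContinuum-16659)

Route `OneFlightGossipEngine`, sub-problem `HydrodynamicLimit`. The open dynamical input S2'' of the skeleton
`Cruxes/KineticCurrentsLDAlongFamilies/Lines/Sketch.lean` asks for exponential tightness, at a rate `s₀` fixed
before the budget `κ`, of the window change `ΔE_ϑ = E_ϑ(Φ_r z) − E_ϑ(z)` of the tested kinetic energy
`E_ϑ(z) = Σᵢ ϑ(xᵢ)‖vᵢ‖²/2` (and of the tested momentum) under the local Gibbs law `λ^N_s`, over the kinetic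
window `r ≤ τ(N+1)^{-1/3}`. Split
`ΔE_ϑ = Σᵢ [ϑ(xᵢ(r)) − ϑ(xᵢ(0))]·‖vᵢ(0)‖²/2  +  Σᵢ ϑ(xᵢ(r))·(‖vᵢ(r)‖² − ‖vᵢ(0)‖²)/2 =: X_disp + X_coll`.
This file proves the tightness of the DISPLACEMENT part `X_disp` in exactly the binder order of S2''
(`∃ s₀ ∀ τ ∀ κ ∀ Φ ∃ N₀ ∀ N ≥ N₀ ∀ s ∈ [0,t₁] ∀ r` in the window), uniformly along a jointly continuous
profile family and for a jointly continuous test family `ϑ_s`, with NO dynamical input beyond energy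
conservation and the path bound `dist(xᵢ(r), xᵢ(0)) ≤ ∫₀ʳ‖vᵢ‖`. What remains open of S2'' is therefore
exactly the COLLISIONAL redistribution `X_coll` (energy exchanged between particles, tested against `ϑ` at the
final positions) plus the momentum transport — the "collision-chain relay at LD slope" of the crux notes.

Proof. Truncate the initial energies at a level `V`: `eᵢ ≤ V + (eᵢ − V)⁺`, so
`|X_disp| ≤ Σᵢ |Δϑᵢ|·V + 2B·T_V(z)`, `T_V = Σᵢ(eᵢ − V)⁺`, `B = sup|ϑ|`. A linear family modulus
`|ϑ_s(x) − ϑ_s(y)| ≤ ω + C_ω·dist(x,y)` (compactness of `[0,t₁] × 𝕋³`) and `Σᵢ distᵢ ≤ Σᵢ∫₀ʳ‖vᵢ‖ ≤ r(N+1) + 2rE(z)`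
give `s₀|X_disp| ≤ (s₀ωV + s₀C_ωVr)(N+1) + 2s₀C_ωVr·E(z) + 2s₀B·T_V(z)` — a sum of one-body functions of the
time-ZERO configuration, whose exponential moment under `λ^N_s` factorises over the Gaussian velocity fibres
(`stub_fibreExpMoment`): per particle `∫ e^{αe + β(e−V)⁺} dM ≤ Ĝ(α) + e^{−βV}Ĝ(α+β)`,
`Ĝ(γ) = e^{γU²}(1−2γΘ)^{-3/2}`. With `s₀ = 1/(16ΘB)` (so `β = 2s₀B = 1/(8Θ)`), choose in this order `V` (tail
`e^{−βV}Ĝ(1/(4Θ)) ≤ κ/4`), `ω = κ/(4s₀V)`, `C_ω`, and `N₀` (so that `s₀C_ωV·τ(N+1)^{-1/3}` is below `κ/8` and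
below the Gaussian exponent `γ₀(κ/4)` of `wre_exists_gamma`).

References: S. Olla, S. R. S. Varadhan, H.-T. Yau, Comm. Math. Phys. 155 (1993) §2; H. Spohn, *Large Scale
Dynamics of Interacting Particles* (1991), Part I §2.3.
-/

noncomputable section

open MeasureTheory Set Filter
open scoped ENNReal Topology InnerProductSpace

namespace Summit.AtomisticToContinuum.HydrodynamicLimit.Theorems.KineticCurrentsLDAlongFamiliesSketch

open Literature.Analysis.FluidPDE (HardSphereFlow Config localMaxwellian canonicalDensity liouville
  hardSphereDomain configEnergy)
open Literature.MathematicalPhysics.KineticTheory (T3 V3 hsDiameter localGibbsLaw localGibbsMeasure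
  localGibbsProfile)
open Literature.Analysis.FluidPDE Literature.MathematicalPhysics.KineticTheory
open Summit.AtomisticToContinuum.HydrodynamicLimit.Theorems.KineticCurrentsWindowLDUniformLocalGibbs
  (wre_exists_gamma)
open Summit.AtomisticToContinuum.HydrodynamicLimit.Theorems.KineticCurrentsWindowLDUniformSketch
  (stub_fibreExpMoment)

/-! ### The displacement tightness along the family -/

/-- **S2''a — displacement transport tightness along a profile family (helper toward the registered
open stub `stub_windowTransportFamily`).** For a jointly continuous positive profile family on
`[0,t₁] × 𝕋³`, `0 < σ ≤ 1/2` and a jointly continuous test family `ϑ_s`, there is a rate `s₀ > 0` such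
that for every `τ > 0`, `κ > 0` and flow family, for all large `N`, uniformly in `s ∈ [0,t₁]` and
`r ∈ [0, τ(N+1)^{-1/3}]`:
`∫ exp(s₀ |Σᵢ (ϑ_s(xᵢ(r)) − ϑ_s(xᵢ(0)))·‖vᵢ(0)‖²/2|) dλ^N_s ≤ e^{κ(N+1)}`.
Decay-free: truncation of the initial energies, a linear family modulus, the path bound, energy
conservation, and Gaussian fibre moments of the time-zero law. [folklore] -/
theorem stub_displacementTightnessFamily :
    ∀ (t₁ : ℝ) (a θ₀ : ℝ → T3 → ℝ) (u₀ : ℝ → T3 → V3),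
    Continuous (Function.uncurry a) → Continuous (Function.uncurry θ₀) →
    Continuous (Function.uncurry u₀) → (∀ s x, 0 < a s x) → (∀ s x, 0 < θ₀ s x) →
    ∀ σ : ℝ, 0 < σ → σ ≤ 1 / 2 →
    ∀ ϑ : ℝ → T3 → ℝ, Continuous (Function.uncurry ϑ) →
    ∃ s₀ : ℝ, 0 < s₀ ∧ ∀ τ : ℝ, 0 < τ → ∀ κ : ℝ, 0 < κ →
    ∀ Φ : (N : ℕ) →
      HardSphereFlow (Literature.Analysis.FluidPDE.Torus.geometry (Fin 3)) (hsDiameter σ N) (N + 1),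
    ∃ N₀ : ℕ, ∀ N : ℕ, N₀ ≤ N → ∀ s ∈ Icc 0 t₁,
    ∀ r ∈ Icc (0 : ℝ) (τ * ((N : ℝ) + 1) ^ (-(1 / 3 : ℝ))),
      ∫⁻ z, ENNReal.ofReal (Real.exp (s₀ *
          |∑ i, (ϑ s ((Φ N).flow r z i).1 - ϑ s (z i).1) * (‖(z i).2‖ ^ 2 / 2)|))
        ∂(localGibbsLaw σ (a s) (u₀ s) (θ₀ s) N (Φ N)) ≤
      ENNReal.ofReal (Real.exp (κ * ((N : ℝ) + 1))) := by
  intro t₁ a θ₀ u₀ ha hθ hu ha0 hθ0 σ hσ hσ2 ϑ hϑ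
  -- uniform bounds on `[0,t₁] × 𝕋³`
  obtain ⟨Θ, hΘ0, hΘ'⟩ := wrf_exists_forall_le_family hθ t₁
  obtain ⟨U, hU0, hU'⟩ := wrf_exists_forall_le_family (f := fun s x => ‖u₀ s x‖) hu.norm t₁
  obtain ⟨B₁, hB₁0, hB₁⟩ := wrf_exists_forall_le_family hϑ t₁
  obtain ⟨B₂, _, hB₂⟩ := wrf_exists_forall_le_family (f := fun s x => -ϑ s x) hϑ.neg t₁
  obtain ⟨B, hBdef⟩ : ∃ B : ℝ, B = max B₁ B₂ := ⟨_, rfl⟩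
  have hB0 : 0 < B := by rw [hBdef]; exact hB₁0.trans_le (le_max_left _ _)
  have hBabs : ∀ s ∈ Icc (0 : ℝ) t₁, ∀ x, |ϑ s x| ≤ B := fun s hs x => by
    rw [hBdef]
    exact abs_le.2 ⟨by linarith [hB₂ s hs x, le_max_right B₁ B₂],
      (hB₁ s hs x).trans (le_max_left _ _)⟩
  -- the rate `s₀ = 1/(16 Θ B)` and the fixed exponents `β = 2 s₀ B = 1/(8Θ)`, `γ₁ = 1/(4Θ)`
  obtain ⟨s₀, hs0⟩ : ∃ s₀ : ℝ, s₀ = 1 / (16 * Θ * B) := ⟨_, rfl⟩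
  have hs00 : 0 < s₀ := by rw [hs0]; positivity
  refine ⟨s₀, hs00, ?_⟩
  intro τ hτ κ hκ Φ
  obtain ⟨β, hβ⟩ : ∃ β : ℝ, β = 2 * s₀ * B := ⟨_, rfl⟩
  have hβ8 : β = 1 / (8 * Θ) := by
    rw [hβ, hs0]
    field_simp
    ring
  have hβ0 : 0 < β := by rw [hβ8]; positivity
  obtain ⟨γ₁, hγ₁⟩ : ∃ γ₁ : ℝ, γ₁ = 1 / (4 * Θ) := ⟨_, rfl⟩
  have hγ₁0 : 0 < γ₁ := by rw [hγ₁]; positivity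
  have hγ₁Θ : 2 * γ₁ * Θ < 1 := by
    rw [hγ₁]
    field_simp
    norm_num
  have hγ₁Θ' : 0 < 1 - 2 * γ₁ * Θ := by linarith only [hγ₁Θ]
  obtain ⟨G₁, hG₁⟩ : ∃ G₁ : ℝ, G₁ = Real.exp (γ₁ * U ^ 2) * (1 - 2 * γ₁ * Θ) ^ (-(3 : ℝ) / 2) :=
    ⟨_, rfl⟩
  have hG₁0 : 0 < G₁ := by
    rw [hG₁]; exact mul_pos (Real.exp_pos _) (Real.rpow_pos_of_pos hγ₁Θ' _)
  obtain ⟨γ₀, hγ00, hγ0Θ, hK₀⟩ := wre_exists_gamma hΘ0 (by positivity : 0 < κ / 4) U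
  -- the truncation level `V`, the tolerance `ω`, the modulus constant `C`
  obtain ⟨V, hV⟩ : ∃ V : ℝ, V = max 1 (Real.log (4 * G₁ / κ) / β) := ⟨_, rfl⟩
  have hV1 : 1 ≤ V := by rw [hV]; exact le_max_left _ _
  have hV0 : 0 < V := one_pos.trans_le hV1
  have htail : Real.exp (-(β * V)) * G₁ ≤ κ / 4 := by
    have h1 : Real.log (4 * G₁ / κ) ≤ β * V := by
      have h := le_max_right 1 (Real.log (4 * G₁ / κ) / β)
      rw [← hV, div_le_iff₀ hβ0] at h
      linarith only [h]
    have h2 : 4 * G₁ / κ ≤ Real.exp (β * V) := by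
      calc 4 * G₁ / κ = Real.exp (Real.log (4 * G₁ / κ)) := (Real.exp_log (by positivity)).symm
        _ ≤ Real.exp (β * V) := Real.exp_le_exp.2 h1
    have h3 : Real.exp (-(β * V)) * Real.exp (β * V) = 1 := by
      rw [← Real.exp_add, neg_add_cancel, Real.exp_zero]
    have h4 : Real.exp (-(β * V)) * (4 * G₁ / κ) ≤ 1 :=
      (mul_le_mul_of_nonneg_left h2 (Real.exp_nonneg _)).trans_eq h3
    have h5 : Real.exp (-(β * V)) * G₁ = κ / 4 * (Real.exp (-(β * V)) * (4 * G₁ / κ)) := by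
      field_simp
    rw [h5]
    calc κ / 4 * (Real.exp (-(β * V)) * (4 * G₁ / κ)) ≤ κ / 4 * 1 :=
          mul_le_mul_of_nonneg_left h4 (by positivity)
      _ = κ / 4 := mul_one _
  obtain ⟨ω, hω⟩ : ∃ ω : ℝ, ω = κ / (4 * s₀ * V) := ⟨_, rfl⟩
  have hω0 : 0 < ω := by rw [hω]; positivity
  have hωV : s₀ * ω * V = κ / 4 := by
    rw [hω]
    field_simp
  obtain ⟨C, hC0, hC⟩ := wdt_abs_sub_le_lin_family hϑ t₁ hω0
  -- the threshold `N₀`: `s₀ C V · w_N` below `κ/8` and `2 s₀ C V · w_N` below `min γ₀ (1/(8Θ))`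
  obtain ⟨αb, hαb⟩ : ∃ αb : ℝ, αb = min γ₀ (1 / (8 * Θ)) := ⟨_, rfl⟩
  have hαb0 : 0 < αb := by rw [hαb]; exact lt_min hγ00 (by positivity)
  obtain ⟨N₁, hN₁⟩ := wdt_exists_N0 τ (s₀ * C * V) (by positivity : 0 < κ / 8)
  obtain ⟨N₂, hN₂⟩ := wdt_exists_N0 τ (2 * (s₀ * C * V)) hαb0
  refine ⟨max N₁ N₂, fun N hN s hsI r hr => ?_⟩
  have hN1 := hN₁ N (le_of_max_le_left hN)
  have hN2 := hN₂ N (le_of_max_le_right hN)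
  -- the profiles at the parameter `s`
  have has : Continuous (a s) := ha.uncurry_left s
  have hθs : Continuous (θ₀ s) := hθ.uncurry_left s
  have hus : Continuous (u₀ s) := hu.uncurry_left s
  have ha0s : ∀ x, 0 < a s x := ha0 s
  have hθ0s : ∀ x, 0 < θ₀ s x := hθ0 s
  -- the exponent `α = 2 s₀ C V r` at this `N, r`
  have hsCV : 0 ≤ s₀ * C * V := by positivity
  obtain ⟨α, hα⟩ : ∃ α : ℝ, α = 2 * (s₀ * C * V) * r := ⟨_, rfl⟩
  have hα0 : 0 ≤ α := by rw [hα]; exact mul_nonneg (by positivity) hr.1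
  have hαle : α ≤ αb := by
    have h1 : α ≤ 2 * (s₀ * C * V) * (τ * ((N : ℝ) + 1) ^ (-(1 / 3 : ℝ))) := by
      rw [hα]; exact mul_le_mul_of_nonneg_left hr.2 (by positivity)
    exact h1.trans hN2.le
  have hαγ₀ : α ≤ γ₀ := hαle.trans (by rw [hαb]; exact min_le_left _ _)
  have hαβ : α + β ≤ γ₁ := by
    have h1 : α ≤ 1 / (8 * Θ) := hαle.trans (by rw [hαb]; exact min_le_right _ _)
    have h2 : 1 / (8 * Θ) + 1 / (8 * Θ) = 1 / (4 * Θ) := by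
      field_simp
      norm_num
    rw [hβ8, hγ₁, ← h2]
    exact add_le_add h1 le_rfl
  have hαβ0 : 0 ≤ α + β := add_nonneg hα0 hβ0.le
  have hαβΘ : 2 * (α + β) * Θ < 1 :=
    (mul_le_mul_of_nonneg_right (mul_le_mul_of_nonneg_left hαβ two_pos.le) hΘ0.le).trans_lt hγ₁Θ
  have hc1 : s₀ * C * V * r ≤ κ / 8 :=
    (mul_le_mul_of_nonneg_left hr.2 hsCV).trans hN1.le
  -- the one-body weight and its fibre bound
  obtain ⟨g, hg⟩ : ∃ g : T3 × V3 → ℝ≥0∞, g = fun y => ENNReal.ofReal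
      (Real.exp (α * (‖y.2‖ ^ 2 / 2) + β * max 0 (‖y.2‖ ^ 2 / 2 - V))) := ⟨_, rfl⟩
  have hgm : Measurable g := by
    rw [hg]
    refine (Real.measurable_exp.comp ?_).ennreal_ofReal
    fun_prop
  obtain ⟨K, hK⟩ : ∃ K : ℝ≥0∞, K = ENNReal.ofReal (Real.exp (κ / 4) + κ / 4) := ⟨_, rfl⟩
  have hfib : ∀ x : T3,
      ∫⁻ v, g (x, v) * ENNReal.ofReal (localMaxwellian 1 (θ₀ s x) (u₀ s x) v) ≤ K := by
    intro x
    have hθx : 0 < θ₀ s x := hθ0s x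
    have hθxΘ : θ₀ s x ≤ Θ := hΘ' s hsI x
    have hux : ‖u₀ s x‖ ≤ U := hU' s hsI x
    -- rewrite as an integral against `gaussMeasure`
    have hM : Measurable fun w : V3 => ENNReal.ofReal (localMaxwellian 1 (θ₀ s x) (u₀ s x) w) :=
      (continuous_localMaxwellian 1 (θ₀ s x) (u₀ s x)).measurable.ennreal_ofReal
    have hgx : Measurable fun w : V3 => g (x, w) := hgm.comp measurable_prodMk_left
    have hrw : ∫⁻ v, g (x, v) * ENNReal.ofReal (localMaxwellian 1 (θ₀ s x) (u₀ s x) v) =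
        ∫⁻ v, ENNReal.ofReal (Real.exp (α * (‖v‖ ^ 2 / 2) + β * max 0 (‖v‖ ^ 2 / 2 - V)))
          ∂gaussMeasure (u₀ s x) (θ₀ s x) := by
      rw [← withDensity_localMaxwellian_eq_gaussMeasure hθx (u₀ s x),
        lintegral_withDensity_eq_lintegral_mul _ hM (by rw [hg] at hgx; exact hgx)]
      refine lintegral_congr fun v => ?_
      simp only [Pi.mul_apply, hg]
      rw [mul_comm]
    rw [hrw]
    -- exponent comparisons at `θ₀ s x ≤ Θ`
    have h2x : 2 * (α + β) * θ₀ s x < 1 :=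
      (mul_le_mul_of_nonneg_left hθxΘ (by positivity)).trans_lt hαβΘ
    have hγ0x : 2 * γ₀ * θ₀ s x < 1 :=
      (mul_le_mul_of_nonneg_left hθxΘ (by positivity)).trans_lt hγ0Θ
    have hγ1x : 2 * γ₁ * θ₀ s x < 1 :=
      (mul_le_mul_of_nonneg_left hθxΘ (by positivity)).trans_lt hγ₁Θ
    have hαθ : 2 * α * θ₀ s x ≤ 2 * γ₀ * θ₀ s x :=
      mul_le_mul_of_nonneg_right (mul_le_mul_of_nonneg_left hαγ₀ two_pos.le) hθx.le
    have hαβθ : 2 * (α + β) * θ₀ s x ≤ 2 * γ₁ * θ₀ s x :=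
      mul_le_mul_of_nonneg_right (mul_le_mul_of_nonneg_left hαβ two_pos.le) hθx.le
    have hmain := wdt_fibre_trunc_moment_le hθx hα0 hβ0.le h2x (u₀ s x) V
    have hA : Real.exp (α * ‖u₀ s x‖ ^ 2) * (1 - 2 * α * θ₀ s x) ^ (-(3 : ℝ) / 2) ≤
        Real.exp (κ / 4) := by
      calc Real.exp (α * ‖u₀ s x‖ ^ 2) * (1 - 2 * α * θ₀ s x) ^ (-(3 : ℝ) / 2)
          ≤ Real.exp (γ₀ * ‖u₀ s x‖ ^ 2) * (1 - 2 * γ₀ * θ₀ s x) ^ (-(3 : ℝ) / 2) := by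
            refine mul_le_mul (Real.exp_le_exp.2 (mul_le_mul_of_nonneg_right hαγ₀ (sq_nonneg _)))
              ?_ (Real.rpow_nonneg (by linarith only [hαθ, hγ0x]) _) (Real.exp_nonneg _)
            exact Real.rpow_le_rpow_of_nonpos (by linarith only [hγ0x])
              (by linarith only [hαθ]) (by norm_num)
        _ ≤ Real.exp (γ₀ * U ^ 2) * (1 - 2 * γ₀ * Θ) ^ (-(3 : ℝ) / 2) :=
            gaussMgfConst_mono hγ00.le (by norm_num) hθxΘ hγ0Θ (norm_nonneg _) hux
        _ ≤ Real.exp (κ / 4) := hK₀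
    have hBt : Real.exp (-(β * V)) *
        (Real.exp ((α + β) * ‖u₀ s x‖ ^ 2) * (1 - 2 * (α + β) * θ₀ s x) ^ (-(3 : ℝ) / 2)) ≤
        κ / 4 := by
      have h1 : Real.exp ((α + β) * ‖u₀ s x‖ ^ 2) * (1 - 2 * (α + β) * θ₀ s x) ^ (-(3 : ℝ) / 2) ≤
          G₁ := by
        calc Real.exp ((α + β) * ‖u₀ s x‖ ^ 2) * (1 - 2 * (α + β) * θ₀ s x) ^ (-(3 : ℝ) / 2)
            ≤ Real.exp (γ₁ * ‖u₀ s x‖ ^ 2) * (1 - 2 * γ₁ * θ₀ s x) ^ (-(3 : ℝ) / 2) := by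
              refine mul_le_mul (Real.exp_le_exp.2 (mul_le_mul_of_nonneg_right hαβ (sq_nonneg _)))
                ?_ (Real.rpow_nonneg (by linarith only [hαβθ, hγ1x]) _) (Real.exp_nonneg _)
              exact Real.rpow_le_rpow_of_nonpos (by linarith only [hγ1x])
                (by linarith only [hαβθ]) (by norm_num)
          _ ≤ G₁ := by
              rw [hG₁]
              exact gaussMgfConst_mono hγ₁0.le (by norm_num) hθxΘ hγ₁Θ (norm_nonneg _) hux
      calc Real.exp (-(β * V)) *
            (Real.exp ((α + β) * ‖u₀ s x‖ ^ 2) * (1 - 2 * (α + β) * θ₀ s x) ^ (-(3 : ℝ) / 2))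
          ≤ Real.exp (-(β * V)) * G₁ := mul_le_mul_of_nonneg_left h1 (Real.exp_nonneg _)
        _ ≤ κ / 4 := htail
    refine hmain.trans ?_
    rw [hK, ENNReal.ofReal_add (Real.exp_nonneg _) (by positivity),
      ← ENNReal.ofReal_mul (Real.exp_nonneg _)]
    exact add_le_add (ENNReal.ofReal_le_ofReal hA) (ENNReal.ofReal_le_ofReal hBt)
  -- the fibrewise product bound under the local Gibbs law
  have hprod : ∫⁻ z, ∏ i, g (z i) ∂(localGibbsLaw σ (a s) (u₀ s) (θ₀ s) N (Φ N)) ≤ K ^ (N + 1) := by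
    rw [localGibbsLaw_eq]
    exact stub_fibreExpMoment (a s) (θ₀ s) (u₀ s) has hθs hus ha0s hθ0s σ hσ hσ2 N g hgm K hfib
  -- the a.e. pathwise bound: `exp(s₀|X|) ≤ e^{(3κ/8)(N+1)} · ∏ᵢ g(zᵢ)`
  have hN0 : (0 : ℝ) ≤ (N : ℝ) + 1 := by positivity
  have hae : ∀ᵐ z ∂(localGibbsLaw σ (a s) (u₀ s) (θ₀ s) N (Φ N)),
      ENNReal.ofReal (Real.exp (s₀ *
          |∑ i, (ϑ s ((Φ N).flow r z i).1 - ϑ s (z i).1) * (‖(z i).2‖ ^ 2 / 2)|)) ≤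
        ENNReal.ofReal (Real.exp (3 * κ / 8 * ((N : ℝ) + 1))) * ∏ i, g (z i) := by
    filter_upwards [ae_mem_good_localGibbsLaw σ (a s) (u₀ s) (θ₀ s) N (Φ N)] with z hz
    have hpath := stub_displacementTightness_prelim (Φ N) hz hC0 (hC s hsI) (hBabs s hsI) hV0.le hr.1
    -- the product is `ofReal (exp (α E + β T_V))`
    have hprodeq : ∏ i, g (z i) = ENNReal.ofReal (Real.exp (α * configEnergy z +
        β * ∑ i, max 0 (‖(z i).2‖ ^ 2 / 2 - V))) := by
      rw [hg]
      rw [← ENNReal.ofReal_prod_of_nonneg (fun i _ => Real.exp_nonneg _), ← Real.exp_sum]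
      congr 2
      rw [Finset.sum_add_distrib, ← Finset.mul_sum, ← Finset.mul_sum]
      congr 2
      show ∑ i, ‖(z i).2‖ ^ 2 / 2 = 2⁻¹ * ∑ i, ‖(z i).2‖ ^ 2
      rw [Finset.mul_sum]
      exact Finset.sum_congr rfl fun i _ => by ring
    rw [hprodeq, ← ENNReal.ofReal_mul (Real.exp_nonneg _), ← Real.exp_add]
    refine ENNReal.ofReal_le_ofReal (Real.exp_le_exp.2 ?_)
    have hn : ((N + 1 : ℕ) : ℝ) = (N : ℝ) + 1 := by push_cast; ring
    have h1 : s₀ * |∑ i, (ϑ s ((Φ N).flow r z i).1 - ϑ s (z i).1) * (‖(z i).2‖ ^ 2 / 2)| ≤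
        s₀ * (ω * V * ((N + 1 : ℕ) : ℝ) + C * V * (r * ((N + 1 : ℕ) : ℝ) + 2 * r * configEnergy z) +
          2 * B * ∑ i, max 0 (‖(z i).2‖ ^ 2 / 2 - V)) :=
      mul_le_mul_of_nonneg_left hpath hs00.le
    rw [hn] at h1
    -- bookkeeping: `s₀ωV = κ/4`, `s₀CVr ≤ κ/8`, `2 s₀ C V r = α`, `2 s₀ B = β`
    have hkey : s₀ * (ω * V * ((N : ℝ) + 1) + C * V * (r * ((N : ℝ) + 1) + 2 * r * configEnergy z) +
          2 * B * ∑ i, max 0 (‖(z i).2‖ ^ 2 / 2 - V)) =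
        (s₀ * ω * V + s₀ * C * V * r) * ((N : ℝ) + 1) + α * configEnergy z +
          β * ∑ i, max 0 (‖(z i).2‖ ^ 2 / 2 - V) := by
      rw [hα, hβ]; ring
    rw [hkey, hωV] at h1
    have h2 : (κ / 4 + s₀ * C * V * r) * ((N : ℝ) + 1) ≤ 3 * κ / 8 * ((N : ℝ) + 1) :=
      mul_le_mul_of_nonneg_right (by linarith only [hc1]) hN0
    linarith only [h1, h2]
  -- assemble
  have hKpow : K ^ (N + 1) ≤ ENNReal.ofReal (Real.exp (κ / 2 * ((N : ℝ) + 1))) := by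
    rw [hK, ← ENNReal.ofReal_pow (by positivity)]
    refine ENNReal.ofReal_le_ofReal ?_
    have h1 : Real.exp (κ / 4) + κ / 4 ≤ Real.exp (κ / 2) := by
      have h4 : 0 ≤ κ / 4 := by positivity
      have he1 : 1 ≤ Real.exp (κ / 4) := Real.one_le_exp h4
      have he2 : 1 + κ / 4 ≤ Real.exp (κ / 4) := by
        have := Real.add_one_le_exp (κ / 4); linarith only [this]
      calc Real.exp (κ / 4) + κ / 4 ≤ Real.exp (κ / 4) + κ / 4 * Real.exp (κ / 4) := by
            have : κ / 4 * 1 ≤ κ / 4 * Real.exp (κ / 4) := mul_le_mul_of_nonneg_left he1 h4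
            linarith only [this]
        _ = Real.exp (κ / 4) * (1 + κ / 4) := by ring
        _ ≤ Real.exp (κ / 4) * Real.exp (κ / 4) :=
            mul_le_mul_of_nonneg_left he2 (Real.exp_nonneg _)
        _ = Real.exp (κ / 2) := by rw [← Real.exp_add]; ring_nf
    calc (Real.exp (κ / 4) + κ / 4) ^ (N + 1) ≤ Real.exp (κ / 2) ^ (N + 1) :=
          pow_le_pow_left₀ (by positivity) h1 _
      _ = Real.exp (κ / 2 * ((N : ℝ) + 1)) := by
          rw [← Real.exp_nat_mul]; congr 1; push_cast; ring
  have hgprod : Measurable fun z : Config (N + 1) (Fin 3) T3 => ∏ i, g (z i) :=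
    Finset.measurable_prod _ fun i _ => hgm.comp (measurable_pi_apply i)
  have hfin : Real.exp (3 * κ / 8 * ((N : ℝ) + 1)) * Real.exp (κ / 2 * ((N : ℝ) + 1)) ≤
      Real.exp (κ * ((N : ℝ) + 1)) := by
    rw [← Real.exp_add, Real.exp_le_exp]
    have : 3 * κ / 8 * ((N : ℝ) + 1) + κ / 2 * ((N : ℝ) + 1) = 7 * κ / 8 * ((N : ℝ) + 1) := by ring
    rw [this]
    exact mul_le_mul_of_nonneg_right (by linarith only [hκ]) hN0
  calc ∫⁻ z, ENNReal.ofReal (Real.exp (s₀ *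
          |∑ i, (ϑ s ((Φ N).flow r z i).1 - ϑ s (z i).1) * (‖(z i).2‖ ^ 2 / 2)|))
        ∂(localGibbsLaw σ (a s) (u₀ s) (θ₀ s) N (Φ N))
      ≤ ∫⁻ z, ENNReal.ofReal (Real.exp (3 * κ / 8 * ((N : ℝ) + 1))) * ∏ i, g (z i)
          ∂(localGibbsLaw σ (a s) (u₀ s) (θ₀ s) N (Φ N)) := lintegral_mono_ae hae
    _ = ENNReal.ofReal (Real.exp (3 * κ / 8 * ((N : ℝ) + 1))) *
          ∫⁻ z, ∏ i, g (z i) ∂(localGibbsLaw σ (a s) (u₀ s) (θ₀ s) N (Φ N)) := by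
        rw [lintegral_const_mul _ hgprod]
    _ ≤ ENNReal.ofReal (Real.exp (3 * κ / 8 * ((N : ℝ) + 1))) *
          ENNReal.ofReal (Real.exp (κ / 2 * ((N : ℝ) + 1))) :=
        mul_le_mul_right (hprod.trans hKpow) _
    _ ≤ ENNReal.ofReal (Real.exp (κ * ((N : ℝ) + 1))) := by
        rw [← ENNReal.ofReal_mul (Real.exp_nonneg _)]
        exact ENNReal.ofReal_le_ofReal hfin

end Summit.AtomisticToContinuum.HydrodynamicLimit.Theorems.KineticCurrentsLDAlongFamiliesSketch

end
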